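import Mathlib.RepresentationTheory.Intertwining
import Mathlib.RepresentationTheory.Invariants
import Mathlib.Algebra.Module.ZMod
import Mathlib.Algebra.Module.Projective
import Mathlib.FieldTheory.Finite.Basic
import Literature.NumberTheory.GaloisRepresentations.LocalGlobalCohomologyDualityProofs
import HarnessLib

/-!
# Counting equivariant homomorphisms into `p`-torsion `G`-modules, `p ∤ #G`
# (cell `b2b-bsdres`, team n1011, row T-EPC = Tate's local Euler–Poincaré characteristic; seat p04 GEN 7; stage A1)

HONEST FRAMING (cell `b2b-bsdres`, run/shared/lean/b2b/bsd-rank1-residual/, verbatim in every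
file): the goal of the cell is to DELETE the COMBINATION-SHAPED residual classes of the
Birch–Swinnerton-Dyer formula for ALL analytic-rank `≤ 1` elliptic curves over `ℚ` — "full BSD
formula for every rank `≤ 1` curve in class `C`" assembled STRICTLY from published theorems — so
that the rank-`≤ 1` remainder becomes exactly the CONSTRUCTION-SHAPED classes, which are TYPED
(missing-input `Prop`s), NOT attempted. This is not "finishing BSD". Team n1011 (N10 / N11, the
additive block X4 ∧ `p = 3`): research route; no claim beyond the stated classes; nothing is
booked; no mark / label is changed by this file. Theorems only (no definition, no named fact, no
`sorry`); TOOL theorems of the representation theory of finite groups.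

## What and why

Row T-EPC discharges the named fact `localEulerPoincareCharacteristic` (Tate; Milne, *ADT* I
Thm. 2.8) carried as `hEP` by every N11 consumer.  Milne's proof computes the class of
`E^× / E^{×p}` in the Grothendieck group of `𝔽_p[G]`-modules (Lemmas 2.11, 2.12) for a finite
Galois extension `E/K` of `p`-adic fields with group `G`.  For `p ∤ #G` the algebra `𝔽_p[G]` is
semisimple, so a finite `𝔽_p[G]`-module `Y` is determined by the numbers `#Hom_G(Z, Y)`, `Z`
ranging over finite `𝔽_p[G]`-modules, and these are ADDITIVE in short exact sequences.  This file
is that counting calculus, phrased for `Representation ℤ G` on additive groups killed by `p`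
(`Representation.IntertwiningMap` = equivariant additive maps), with no module structure over
`ZMod p` in any statement:

* `ModPRepCount.natCard_intertwiningMap_eq_mul` — for `0 → A → B → C → 0` exact with `pB = 0`,
  `pZ = 0`, `p ∤ #G`: `#Hom_G(Z, B) = #Hom_G(Z, A) · #Hom_G(Z, C)` (right exactness: lift through
  the `𝔽_p`-vector space `Z`, average, divide by `#G`);
* `ModPRepCount.natCard_intertwiningMap_trivial` / `…_zmod` — for trivial action on `T`:
  `#Hom_G(Z, T) = #Hom(Z^G, T)`; `#Hom_G(Z, ℤ/p) = #Z^G`;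
* `ModPRepCount.natCard_intertwiningMap_of_free` — if `Y = ⊕_{g ∈ G} g·Y₀` is freely generated
  over `G` by a subgroup `Y₀` (an induced module), `#Hom_G(Z, Y) = #Hom(Z, Y₀)` (Frobenius
  reciprocity, numerically);
* `ModPRepCount.natCard_addMonoidHom_of_card_eq_pow` — `#Hom(Z, A) = #A ^ r` for `#Z = p^r`,
  `pZ = pA = 0`;
* transport along equivalences of representations; existence of averaged intertwining maps.

References: J. S. Milne, *Arithmetic Duality Theorems*, 2nd ed. (2006), I §2, proof of Thm. 2.8
(Lemmas 2.11, 2.12) [MilneADT2006]; J.-P. Serre, *Galois Cohomology* (1997), I §2.4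
[SerreGaloisCohomology1997].
-/

noncomputable section

open Function

namespace Summit.BirchSwinnertonDyer.Rank1Residual.GaloisImage

namespace ModPRepCount

open Representation

variable {G : Type*} [Group G]
variable {Z : Type*} [AddCommGroup Z] {A : Type*} [AddCommGroup A] {B : Type*} [AddCommGroup B]
  {C : Type*} [AddCommGroup C] (σ : Representation ℤ G Z) (α : Representation ℤ G A) (β : Representation ℤ G B)
  (γ : Representation ℤ G C)

omit [Group G] in
/-- For `p ∤ #G` there is an integer `c` with `(c · #G) • x = x` for every `x` killed by `p`.
[folklore] -/
theorem exists_int_mul_card_smul_eq {p : ℕ} [hp : Fact p.Prime] [Finite G] (hG : ¬ p ∣ Nat.card G) :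
    ∃ c : ℤ, ∀ {M : Type*} [AddCommGroup M] (x : M), p • x = 0 → (c * Nat.card G) • x = x := by
  have hcop : Nat.Coprime (Nat.card G) p := (Nat.Prime.coprime_iff_not_dvd hp.out).2 hG |>.symm
  obtain ⟨a, b, hab⟩ := Nat.isCoprime_iff_coprime.2 hcop
  refine ⟨a, fun x hx => ?_⟩
  have h1 : (a * (Nat.card G : ℤ)) = 1 - b * p := by linarith
  rw [h1, sub_smul, one_smul, mul_smul, natCast_zsmul, hx, smul_zero, sub_zero]

/-- `Hom_G(Z, Y)` is finite when `Z` and `Y` are. [folklore] -/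
theorem finite_intertwiningMap [Finite Z] [Finite B] : Finite (IntertwiningMap σ β) :=
  Finite.of_injective (fun f : IntertwiningMap σ β => (f : Z → B)) DFunLike.coe_injective

/-- An intertwining map with `p`-torsion source takes `p`-torsion values. [folklore] -/
theorem nsmul_apply_eq_zero {p : ℕ} (hZ : ∀ z : Z, p • z = 0) (f : IntertwiningMap σ β) (z : Z) :
    p • f z = 0 := by
  rw [← map_nsmul, hZ, map_zero]

/-- **Transport on the right**: `#Hom_G(Z, B) = #Hom_G(Z, C)` for equivalent `B ≃ C`. [folklore] -/
theorem natCard_intertwiningMap_congr_right (e : β.Equiv γ) :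
    Nat.card (IntertwiningMap σ β) = Nat.card (IntertwiningMap σ γ) := by
  refine Nat.card_congr
    { toFun := fun h => e.toIntertwiningMap.comp h
      invFun := fun h => e.symm.toIntertwiningMap.comp h
      left_inv := fun h => DFunLike.ext _ _ fun z => ?_
      right_inv := fun h => DFunLike.ext _ _ fun z => ?_ }
  · rw [IntertwiningMap.comp_apply, IntertwiningMap.comp_apply]
    exact e.symm_apply_apply (h z)
  · rw [IntertwiningMap.comp_apply, IntertwiningMap.comp_apply]
    exact e.apply_symm_apply (h z)

/-- **Transport on the left**: `#Hom_G(Z, B) = #Hom_G(Z', B)` for equivalent `Z ≃ Z'`. [folklore] -/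
theorem natCard_intertwiningMap_congr_left {Z' : Type*} [AddCommGroup Z']
    (σ' : Representation ℤ G Z') (e : σ.Equiv σ') :
    Nat.card (IntertwiningMap σ β) = Nat.card (IntertwiningMap σ' β) := by
  refine Nat.card_congr
    { toFun := fun h => h.comp e.symm.toIntertwiningMap
      invFun := fun h => h.comp e.toIntertwiningMap
      left_inv := fun h => DFunLike.ext _ _ fun z => ?_
      right_inv := fun h => DFunLike.ext _ _ fun z => ?_ }
  · rw [IntertwiningMap.comp_apply, IntertwiningMap.comp_apply]
    exact congrArg h (e.symm_apply_apply z)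
  · rw [IntertwiningMap.comp_apply, IntertwiningMap.comp_apply]
    exact congrArg h (e.apply_symm_apply z)

/-! ### Averaging -/

section Average

variable [Fintype G]

/-- **The averaged map `z ↦ ∑_{g ∈ G} g · h(g⁻¹ z)` of an additive `h : Z → B` is `G`-equivariant**
(Serre's `cor ∘ res`; the projection onto `Hom_G` up to the factor `#G`). We state it as the
existence of an intertwining map with these values. [cite: SerreGaloisCohomology1997, I §2.4] -/
theorem exists_intertwiningMap_average (h : Z →ₗ[ℤ] B) :
    ∃ F : IntertwiningMap σ β, ∀ z, F z = ∑ g : G, β g (h (σ g⁻¹ z)) := by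
  let av : Z →ₗ[ℤ] B := ∑ g : G, (β g).comp (h.comp (σ g⁻¹))
  have hav : ∀ z, av z = ∑ g : G, β g (h (σ g⁻¹ z)) := fun z => by
    simp [av, LinearMap.sum_apply]
  refine ⟨av.intertwiningMap_of_isIntertwiningMap σ β (fun k z => ?_), hav⟩
  rw [hav, hav, map_sum]
  refine (Fintype.sum_equiv (Equiv.mulLeft k) (fun g => β (k * g) (h (σ (k * g)⁻¹ (σ k z))))
    (fun g => β g (h (σ g⁻¹ (σ k z)))) (fun g => rfl)).symm.trans ?_
  refine Finset.sum_congr rfl fun g _ => ?_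
  rw [map_mul, Module.End.mul_apply, mul_inv_rev, map_mul, Module.End.mul_apply, σ.inv_self_apply]

/-- If `g ∘ h = k` with `g`, `k` equivariant, then `g (∑_x x h(x⁻¹ z)) = #G • k z`. [folklore] -/
theorem apply_sum_eq_card_smul (g : IntertwiningMap β γ) (h : Z →ₗ[ℤ] B) (k : IntertwiningMap σ γ)
    (hk : ∀ z, g (h z) = k z) (z : Z) :
    g (∑ x : G, β x (h (σ x⁻¹ z))) = (Fintype.card G) • k z := by
  rw [map_sum]
  simp_rw [g.isIntertwining, hk, k.isIntertwining, γ.self_inv_apply]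
  rw [Finset.sum_const, Finset.card_univ]

end Average

/-! ### Lifting through surjections (`𝔽_p`-vector spaces are projective) -/

omit [Group G] in
/-- Linear maps out of an `𝔽_p`-vector space lift through surjections (module-structure form;
Mathlib `Module.projective_lifting_property`). [folklore] -/
theorem exists_comp_eq_of_surjective_zmod {p : ℕ} [Fact p.Prime] [Module (ZMod p) Z]
    [Module (ZMod p) B] [Module (ZMod p) C] (g : B →ₗ[ZMod p] C) (hg : Surjective g)
    (f : Z →ₗ[ZMod p] C) : ∃ h : Z →ₗ[ZMod p] B, g ∘ₗ h = f :=
  Module.projective_lifting_property g f hg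

omit [Group G] in
/-- An additive map from a `p`-torsion group `Z` into the target of a surjection `B → C` of
`p`-torsion groups lifts to `B` (`Z` is a free `𝔽_p`-module). [folklore] -/
theorem exists_comp_eq_of_surjective {p : ℕ} [hp : Fact p.Prime] (hZ : ∀ z : Z, p • z = 0)
    (hB : ∀ b : B, p • b = 0) (g : B →ₗ[ℤ] C) (hg : Surjective g) (f : Z →ₗ[ℤ] C) :
    ∃ h : Z →ₗ[ℤ] B, g ∘ₗ h = f := by
  have hC : ∀ c : C, p • c = 0 := fun c => by
    obtain ⟨b, rfl⟩ := hg c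
    rw [← map_nsmul, hB, map_zero]
  letI : Module (ZMod p) Z := AddCommGroup.zmodModule hZ
  letI : Module (ZMod p) B := AddCommGroup.zmodModule hB
  letI : Module (ZMod p) C := AddCommGroup.zmodModule hC
  obtain ⟨h', hh'⟩ := exists_comp_eq_of_surjective_zmod (Z := Z) (g.toAddMonoidHom.toZModLinearMap p)
    (fun c => hg c) (f.toAddMonoidHom.toZModLinearMap p)
  refine ⟨h'.toAddMonoidHom.toIntLinearMap, LinearMap.ext fun z => ?_⟩
  exact LinearMap.congr_fun hh' z

/-! ### Exactness: `#Hom_G(Z, B) = #Hom_G(Z, A) · #Hom_G(Z, C)` -/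

/-- **`Hom_G(Z, ·)` is exact on short exact sequences of `p`-torsion `G`-modules when `p ∤ #G`**
(`Z` killed by `p`): for `0 → A → B → C → 0` exact with `pB = 0`,
`#Hom_G(Z, B) = #Hom_G(Z, A) · #Hom_G(Z, C)`.  Right exactness: lift, then average and divide by
`#G`; left exactness is formal.  This is the additivity of `M ↦ dim Hom_{𝔽_p[G]}(Z, M)` on the
Grothendieck group `R_{𝔽_p}(G)` on which Milne's proof of I Thm. 2.8 runs ("both sides … are
additive in `M`"). [cite: MilneADT2006, I §2 (proof of Thm. 2.8, Lemmas 2.10–2.12)] -/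
theorem natCard_intertwiningMap_eq_mul {p : ℕ} [hp : Fact p.Prime] [Finite G] (hG : ¬ p ∣ Nat.card G)
    [Finite Z] [Finite A] [Finite B] [Finite C]
    (f : IntertwiningMap α β) (g : IntertwiningMap β γ) (hf : Injective f) (hg : Surjective g)
    (hfg : LinearMap.range f.toLinearMap = LinearMap.ker g.toLinearMap)
    (hZ : ∀ z : Z, p • z = 0) (hB : ∀ b : B, p • b = 0) :
    Nat.card (IntertwiningMap σ β) = Nat.card (IntertwiningMap σ α) * Nat.card (IntertwiningMap σ γ) := by
  classical
  haveI := Fintype.ofFinite G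
  haveI := finite_intertwiningMap σ α
  haveI := finite_intertwiningMap σ β
  haveI := finite_intertwiningMap σ γ
  obtain ⟨c, hc⟩ := exists_int_mul_card_smul_eq (G := G) hG
  -- post-composition with `g`
  let Φ : IntertwiningMap σ β →+ IntertwiningMap σ γ :=
    AddMonoidHom.mk' (fun h => g.comp h) (IntertwiningMap.add_comp _ _ _ g)
  have hΦ_apply : ∀ (h : IntertwiningMap σ β) (z : Z), Φ h z = g (h z) := fun h z => rfl
  -- right exactness: `Φ` is surjective
  have hΦ : Surjective Φ := by
    intro k
    obtain ⟨h, hh⟩ := exists_comp_eq_of_surjective hZ hB g.toLinearMap hg k.toLinearMap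
    obtain ⟨F, hF⟩ := exists_intertwiningMap_average σ β h
    refine ⟨c • F, DFunLike.ext _ _ fun z => ?_⟩
    rw [hΦ_apply, IntertwiningMap.coe_zsmul, Pi.smul_apply, map_zsmul, hF,
      apply_sum_eq_card_smul σ β γ g h k (fun z => LinearMap.congr_fun hh z) z,
      ← natCast_zsmul, smul_smul, ← Nat.card_eq_fintype_card]
    exact hc (k z) (nsmul_apply_eq_zero σ γ hZ k z)
  -- left exactness: `ker Φ ≃ Hom_G(Z, A)`
  have hgf : ∀ a : A, g (f a) = 0 := fun a => by
    have : f a ∈ LinearMap.ker g.toLinearMap := hfg ▸ LinearMap.mem_range_self f.toLinearMap a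
    exact this
  have hker : Nat.card Φ.ker = Nat.card (IntertwiningMap σ α) := by
    refine (Nat.card_congr (Equiv.ofBijective (fun k : IntertwiningMap σ α =>
      (⟨f.comp k, ?_⟩ : Φ.ker)) ⟨?_, ?_⟩)).symm
    · rw [AddMonoidHom.mem_ker]
      exact DFunLike.ext _ _ fun z => by
        rw [hΦ_apply, IntertwiningMap.comp_apply, IntertwiningMap.coe_zero, Pi.zero_apply]
        exact hgf (k z)
    · intro k₁ k₂ h
      have h' : ∀ z, f (k₁ z) = f (k₂ z) := fun z => by
        have := congrArg (fun x : Φ.ker => (x : IntertwiningMap σ β) z) h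
        simpa only [IntertwiningMap.comp_apply] using this
      exact DFunLike.ext _ _ fun z => hf (h' z)
    · rintro ⟨k, hk⟩
      have hk' : ∀ z, g (k z) = 0 := fun z => by
        have := congrArg (fun x : IntertwiningMap σ γ => x z) ((AddMonoidHom.mem_ker).1 hk)
        simpa only [hΦ_apply, IntertwiningMap.coe_zero, Pi.zero_apply] using this
      have hmem : ∀ z, k z ∈ LinearMap.range f.toLinearMap := fun z => by
        rw [hfg]; exact hk' z
      let e := LinearEquiv.ofInjective f.toLinearMap hf
      let k₀ : Z →ₗ[ℤ] A := e.symm.toLinearMap ∘ₗ LinearMap.codRestrict _ k.toLinearMap hmem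
      have hk₀ : ∀ z, f (k₀ z) = k z := fun z => by
        have h1 : (f.toLinearMap (e.symm (LinearMap.codRestrict _ k.toLinearMap hmem z)) : B) =
            ((e (e.symm (LinearMap.codRestrict _ k.toLinearMap hmem z)) :
              LinearMap.range f.toLinearMap) : B) :=
          (LinearEquiv.ofInjective_apply f.toLinearMap (h := hf) _).symm
        rw [LinearEquiv.apply_symm_apply] at h1
        exact h1
      refine ⟨k₀.intertwiningMap_of_isIntertwiningMap σ α (fun x z => hf ?_), Subtype.ext
        (DFunLike.ext _ _ fun z => ?_)⟩
      · rw [hk₀, k.isIntertwining, f.isIntertwining, hk₀]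
      · rw [IntertwiningMap.comp_apply]
        exact hk₀ z
  -- count
  rw [AddSubgroup.card_eq_card_quotient_mul_card_addSubgroup Φ.ker, hker,
    Nat.card_congr (QuotientAddGroup.quotientKerEquivOfSurjective _ hΦ).toEquiv, mul_comm]

/-! ### Trivial target: `#Hom_G(Z, T) = #Hom(Z^G, T)` -/

/-- **Equivariant maps to a trivial module**: for `T` with trivial `G`-action, `Z` killed by `p` and
`p ∤ #G`, restriction to the invariants is a bijection `Hom_G(Z, T) ≃ Hom(Z^G, T)` (inverse
`φ ↦ (z ↦ c · φ(N_G z))`, `c · #G ≡ 1 (mod p)`), so `#Hom_G(Z, T) = #Hom(Z^G, T)`: the functor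
`Hom_G(·, T)` only sees the trivial isotypic component `Z^G = N_G Z`.
[cite: SerreGaloisCohomology1997, I §2.4] -/
theorem natCard_intertwiningMap_trivial {p : ℕ} [hp : Fact p.Prime] [Finite G] (hG : ¬ p ∣ Nat.card G)
    {T : Type*} [AddCommGroup T] (τ : Representation ℤ G T) (hτ : ∀ (g : G) (t : T), τ g t = t)
    (hZ : ∀ z : Z, p • z = 0) :
    Nat.card (IntertwiningMap σ τ) = Nat.card (σ.invariants →+ T) := by
  classical
  haveI := Fintype.ofFinite G
  obtain ⟨c, hc⟩ := exists_int_mul_card_smul_eq (G := G) hG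
  have hnorm : ∀ z : Z, σ.norm z ∈ σ.invariants := fun z g => σ.self_norm_apply g z
  have hnorm_inv : ∀ z : σ.invariants, σ.norm (z : Z) = (Nat.card G) • (z : Z) := fun z => by
    rw [Representation.norm, LinearMap.sum_apply, Finset.sum_congr rfl fun g _ => z.2 g, Finset.sum_const,
      Finset.card_univ, Nat.card_eq_fintype_card]
  let R : IntertwiningMap σ τ → (σ.invariants →+ T) := fun f =>
    f.toLinearMap.toAddMonoidHom.comp σ.invariants.subtype.toAddMonoidHom
  have hR : ∀ (f : IntertwiningMap σ τ) (z : Z), (Nat.card G) • f z = R f ⟨σ.norm z, hnorm z⟩ := by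
    intro f z
    change (Nat.card G) • f z = f (σ.norm z)
    rw [Representation.norm, LinearMap.sum_apply, map_sum]
    simp_rw [f.isIntertwining, hτ]
    rw [Finset.sum_const, Finset.card_univ, Nat.card_eq_fintype_card]
  refine Nat.card_congr (Equiv.ofBijective R ⟨fun f₁ f₂ h => ?_, fun φ => ?_⟩)
  · refine DFunLike.ext _ _ fun z => ?_
    rw [← hc (f₁ z) (nsmul_apply_eq_zero σ τ hZ f₁ z), ← hc (f₂ z) (nsmul_apply_eq_zero σ τ hZ f₂ z),
      mul_smul, mul_smul, natCast_zsmul, natCast_zsmul, hR, hR, h]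
  · let f₀ : Z →ₗ[ℤ] T := c • (φ.toIntLinearMap ∘ₗ (LinearMap.codRestrict σ.invariants σ.norm hnorm))
    have hf₀ : ∀ z, f₀ z = c • φ ⟨σ.norm z, hnorm z⟩ := fun z => rfl
    refine ⟨f₀.intertwiningMap_of_isIntertwiningMap σ τ (fun g z => ?_), AddMonoidHom.ext fun z => ?_⟩
    · rw [hτ, hf₀, hf₀]
      congr 2
      exact Subtype.ext (σ.norm_self_apply g z)
    · change f₀ (z : Z) = φ z
      rw [hf₀]
      have : (⟨σ.norm (z : Z), hnorm z⟩ : σ.invariants) = (Nat.card G) • z :=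
        Subtype.ext (by
          change σ.norm (z : Z) = ((Nat.card G • z : σ.invariants) : Z)
          rw [Submodule.coe_smul_of_tower]
          exact hnorm_inv z)
      rw [this, map_nsmul, ← natCast_zsmul, smul_smul]
      exact hc (φ z) (by rw [← map_nsmul, show p • z = 0 from Subtype.ext (by
        change p • (z : Z) = 0; exact hZ z), map_zero])

/-- **`#Hom_G(Z, ℤ/p) = #Z^G`** for `Z` killed by `p` and `p ∤ #G` (trivial action on `ℤ/p`;
duality of finite `𝔽_p`-vector spaces `#Hom(Z^G, ℤ/p) = #Z^G`, tree `Nat.card_addMonoidHom_zmod`).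
[cite: MilneADT2006, I §0 (0.19)] -/
theorem natCard_intertwiningMap_zmod {p : ℕ} [hp : Fact p.Prime] [Finite G] (hG : ¬ p ∣ Nat.card G)
    [Finite Z] (hZ : ∀ z : Z, p • z = 0) :
    Nat.card (IntertwiningMap σ (Representation.trivial ℤ G (ZMod p))) = Nat.card σ.invariants := by
  rw [natCard_intertwiningMap_trivial σ hG (Representation.trivial ℤ G (ZMod p)) (fun g t => rfl) hZ]
  haveI : Finite σ.invariants := Finite.of_injective _ Subtype.coe_injective
  exact Literature.NumberTheory.GaloisRepresentations.Nat.card_addMonoidHom_zmod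
    fun z : σ.invariants => Subtype.ext (by change p • (z : Z) = 0; exact hZ z)

/-! ### Induced modules: `#Hom_G(Z, ⊕_g g Y₀) = #Hom(Z, Y₀)` -/

section Free

variable [Fintype G] {Y : Type*} [AddCommGroup Y] (τ : Representation ℤ G Y) (Y₀ : AddSubgroup Y)

/-- `τ(k) (∑_g g c_g) = ∑_g g c_{k⁻¹ g}`. [folklore] -/
theorem apply_sum_apply_eq (k : G) (c : G → Y₀) :
    τ k (∑ g : G, τ g (c g : Y)) = ∑ g : G, τ g (c (k⁻¹ * g) : Y) := by
  rw [map_sum]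
  refine Fintype.sum_equiv (Equiv.mulLeft k) _ _ fun g => ?_
  change τ k (τ g (c g : Y)) = τ (k * g) (c (k⁻¹ * (k * g)) : Y)
  rw [inv_mul_cancel_left, map_mul, Module.End.mul_apply]

/-- **Frobenius reciprocity, numerically**: if `Y` is freely generated over `G` by the subgroup
`Y₀`, i.e. `Φ : (c_g)_g ↦ ∑_g g c_g : Y₀^G → Y` is bijective (`Y ≅ ℤ[G] ⊗ Y₀` is induced from the
trivial group), then `Hom_G(Z, Y) ≃ Hom(Z, Y₀)` by `f ↦ pr₁ ∘ f`, with inverse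
`φ ↦ (z ↦ ∑_g g φ(g⁻¹ z))`; hence `#Hom_G(Z, Y) = #Hom(Z, Y₀)`.  This is the count
`χ(G, Ind N) = χ(N)` of Milne's reduction. [cite: MilneADT2006, I §2 (proof of Thm. 2.8, after Lemma 2.10)] -/
theorem natCard_intertwiningMap_of_free (Φ : (G → Y₀) →+ Y)
    (hΦ : ∀ c, Φ c = ∑ g : G, τ g (c g : Y)) (hY : Bijective Φ) :
    Nat.card (IntertwiningMap σ τ) = Nat.card (Z →+ Y₀) := by
  classical
  let e : (G → Y₀) ≃+ Y := AddEquiv.ofBijective Φ hY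
  let π : Y →+ Y₀ := (Pi.evalAddMonoidHom (fun _ : G => Y₀) 1).comp e.symm.toAddMonoidHom
  have hπ : ∀ c : G → Y₀, π (Φ c) = c 1 := fun c => by
    change (e.symm (e c)) 1 = c 1
    rw [e.symm_apply_apply]
  have he : ∀ y : Y, Φ (e.symm y) = y := fun y => e.apply_symm_apply y
  -- the backward map: average of `Y₀ ↪ Y ∘ φ`
  have hS : ∀ φ : Z →+ Y₀, ∃ F : IntertwiningMap σ τ, ∀ z, F z = Φ (fun g => φ (σ g⁻¹ z)) := by
    intro φ
    obtain ⟨F, hF⟩ := exists_intertwiningMap_average σ τ (Y₀.subtype.toIntLinearMap ∘ₗ φ.toIntLinearMap)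
    exact ⟨F, fun z => by rw [hF, hΦ]; rfl⟩
  choose S hS using hS
  let R : IntertwiningMap σ τ → (Z →+ Y₀) := fun f => π.comp f.toLinearMap.toAddMonoidHom
  refine Nat.card_congr
    { toFun := R, invFun := S
      left_inv := fun f => DFunLike.ext _ _ fun z => ?_
      right_inv := fun φ => AddMonoidHom.ext fun z => ?_ }
  · -- `S (R f) = f`
    rw [hS]
    set c := e.symm (f z) with hc
    have hfz : f z = Φ c := (he (f z)).symm
    have hcoord : ∀ g : G, (R f) (σ g⁻¹ z) = c g := fun g => by
      change π (f (σ g⁻¹ z)) = c g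
      rw [f.isIntertwining, hfz, hΦ, apply_sum_apply_eq, ← hΦ, hπ, inv_inv, mul_one]
    simp_rw [hcoord]
    exact hfz.symm
  · -- `R (S φ) = φ`
    change π (S φ z) = φ z
    rw [hS, hπ, inv_one, map_one, Module.End.one_apply]

end Free

/-! ### `#Hom(Z, A) = #A ^ r` for `#Z = p ^ r` -/

omit [Group G] in
/-- `#Hom_{𝔽_p}(Z, A) = #A ^ r` for an `𝔽_p`-vector space `Z` of order `p ^ r` (module-structure
form). [folklore] -/
theorem natCard_linearMap_zmod_of_card_eq_pow {p r : ℕ} [hp : Fact p.Prime] [Finite Z]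
    [Module (ZMod p) Z] [Module (ZMod p) A] (hcard : Nat.card Z = p ^ r) :
    Nat.card (Z →ₗ[ZMod p] A) = Nat.card A ^ r := by
  classical
  let b := Module.Free.chooseBasis (ZMod p) Z
  haveI : Finite (Module.Free.ChooseBasisIndex (ZMod p) Z) := Finite.of_injective b b.injective
  have h : Nat.card Z = p ^ Nat.card (Module.Free.ChooseBasisIndex (ZMod p) Z) := by
    rw [Nat.card_congr b.equivFun.toEquiv, Nat.card_fun, Nat.card_zmod]
  have hr : Nat.card (Module.Free.ChooseBasisIndex (ZMod p) Z) = r :=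
    Nat.pow_right_injective hp.out.two_le (h.symm.trans hcard)
  have e₂ : (Z →ₗ[ZMod p] A) ≃ (Module.Free.ChooseBasisIndex (ZMod p) Z → A) :=
    (b.constr ℕ (M' := A)).toEquiv.symm
  rw [Nat.card_congr e₂, Nat.card_fun, hr]

omit [Group G] in
/-- **Counting additive maps out of an elementary abelian `p`-group**: if `pZ = 0`, `#Z = p^r` and
`pA = 0`, then `#Hom(Z, A) = #A ^ r` (`Z ≅ (ℤ/p)^r`). [folklore] -/
theorem natCard_addMonoidHom_of_card_eq_pow {p r : ℕ} [hp : Fact p.Prime] [Finite Z]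
    (hZ : ∀ z : Z, p • z = 0) (hA : ∀ a : A, p • a = 0) (hcard : Nat.card Z = p ^ r) :
    Nat.card (Z →+ A) = Nat.card A ^ r := by
  letI : Module (ZMod p) Z := AddCommGroup.zmodModule hZ
  letI : Module (ZMod p) A := AddCommGroup.zmodModule hA
  have e₁ : (Z →+ A) ≃ (Z →ₗ[ZMod p] A) :=
    { toFun := fun f => f.toZModLinearMap p
      invFun := fun f => f.toAddMonoidHom
      left_inv := fun _ => rfl
      right_inv := fun _ => rfl }
  rw [Nat.card_congr e₁]
  exact natCard_linearMap_zmod_of_card_eq_pow hcard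

end ModPRepCount

end Summit.BirchSwinnertonDyer.Rank1Residual.GaloisImage

end
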